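import Literature.Barriers.AtomisticToContinuum.HalfFillingReflectionPositivity
import Literature.MathematicalPhysics.QuantumLattice.XYOrderIntegralProofs
import Literature.Probability.LatticeModels.LatticeGreenRiemannSum
import HarnessLib

/-!
# Hard-core lattice bosons at half filling: the finite-volume architecture of the BEC proof

`Literature/Barriers/AtomisticToContinuum`; decomposition file for the named fact
`Literature.Barriers.AtomisticToContinuum.HalfFillingReflectionPositivity` (item
`provefact-Literature.Barriers.AtomisticToContinuum.HalfFillingReflectionPositivity`): BEC = off-diagonal
long-range order for the hard-core lattice Bose gas at half filling in the staggered field `λ`,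
`H = -Σ_{⟨xy⟩}(S¹_xS¹_y + S²_xS²_y) + λΣ_x[½ + (-1)^x S³_x]` (`hardCoreLatticeGas`, [LSSY2005]
(11.2)), on the even tori `(ℤ/2kℤ)^d`, `d ≥ 3`, for small `λ ≥ 0` and large `β`
([LSSY2005] Ch. 11 §11.3; [AizenmanEtAl2004]).

The printed proof ([LSSY2005] (11.8)–(11.27), after [DLS1978]) runs: reflection positivity and
Gaussian domination for the Gibbs state (Trotter formula) ⇒ infrared bound for the Duhamel
two-point function `(S̃¹_p, S̃¹_{-p}) ≤ 1/(2βE_p)` (11.8) ⇒ by the Falk–Bruch / Dyson–Lieb–Simon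
transfer (11.22) and `coth x ≤ 1 + 1/x` a bound on the thermal structure factor in terms of the
double commutator (11.20)–(11.21), the sum rule (11.24′) and the thermodynamic limit.  For the
last two steps we follow the variant of Kennedy–Lieb–Shastry [KLS1988PRL] eqs. (3)–(8) (sum rule
weighted by `cos pᵢ`, Kubo's inequality, the lattice integral `I(d)`), whose zero-temperature,
`λ = 0` version is the tree's theorem `Literature.MathematicalPhysics.QuantumLattice.kennedy_lieb_shastry_xy_ground_holds`
(`XYOrder*.lean`): at positive temperature the Falk–Bruch transfer adds the term `1/(2βE_p)` to
the KLS infrared bound (4), the thermal energy exceeds the ground-state energy by at most the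
entropy `|Λ| log 2/β`, and the staggered field enters every estimate at order `λ`; the extra
thermal term is summable in the limit exactly when `d ≥ 3` (`∫dp/E_p < ∞`, the tree's
`Literature.Probability.LatticeModels.torusGreen_tendsto_latticeGreen`).  This keeps the numerical input at the value
already certified in the tree (`Literature.MathematicalPhysics.QuantumLattice.klsRiemannSum_eventually_le`, `limsup R_L < 1/√2`),
whereas the route printed in [LSSY2005] (11.23)–(11.26) (Schwarz in `p`, the energy bound
(11.24)) needs the value `c₃ ≈ 0.505` of the Watson integral.

This file vendors the finite-volume intermediate results as named facts about the Gibbs state of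
`hardCoreLatticeGas d L λ` (spin ½, i.e. `n = 1` in the tree's spin vocabulary) and PROVES the
assembly `HalfFillingReflectionPositivity_of_facts`; the facts are discharged in sibling files.

* (Aᵀ) `hc_infraredBound_thermal` — for `p ≠ 0` on even tori,
  `0 ≤ ĝ¹_p ≤ 1/(2βE_p) + ½[(Σᵢ(e₁ - e₃ cos pᵢ) + λ/4)/E_p]^{1/2}`: Gaussian domination
  [LSSY2005] (11.12) / [DLS1978] Thm. 4.2, the Duhamel bound (11.8) / [DLS1978] (44), the
  transfer [DLS1978] Thms. 3.1–3.2 with `coth x ≤ 1 + 1/x` [LSSY2005] (11.22)–(11.23), and the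
  double commutator (11.20).
* (Bᵀ) `hc_kubo_thermal` — `|e₃| ≤ e₁ + λ/d` (Kubo's inequality at positive temperature, by the
  Peierls–Bogoliubov inequality in place of the variational principle; [KLS1988PRL] after (4)).
* (Cᵀ) `hc_sumRule` — the sum rule [KLS1988PRL] (3), (6) (Parseval; state independent).
* (Dᵀ) `hc_bondCorr_lower_thermal` — `e₁ ≥ 1/8 - λ/(4d) - log 2/(2dβ)` (variational bound
  [KLS1988PRL] after (8) plus the entropy bound `⟨H⟩_β ≤ E₀ + |Λ| log 2/β`).
* (Sᵀ) `hc_corr_one_eq_zero` — `⟨S²_xS²_y⟩ = ⟨S¹_xS¹_y⟩` (rotations about the 3-axis commute with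
  `H`, [LSSY2005] after (11.2)).
* (Tᵀ) `hc_corr_abs_le` — `|⟨Sᵅ_xSᵅ_y⟩| ≤ ¼`.

Assembly (proved): (Cᵀ) at `α = 1` split at `p = 0`; (Aᵀ)+(Bᵀ) give
`e₁ ≤ |Λ|⁻¹ĝ¹₀ + ½(e₁ + λ/d)^{1/2} R_L + T_L/(2β)` with `R_L` the punctured Riemann sum of the
KLS integrand (`Literature.MathematicalPhysics.QuantumLattice.klsRiemannSum`) and `T_L = |Λ|⁻¹Σ_{p≠0} E_p⁻¹`
(`Literature.StatMech.torusGreen 0`); (Dᵀ) and the monotonicity of `t ↦ t - ½R√(t + λ/d)`; finally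
`limsup R_L < 1/√2` (`klsRiemannSum_eventually_le`) and `T_L → c_d < ∞` for `d ≥ 3`
(`torusGreen_tendsto_latticeGreen`) leave, for `λ < λ₀(d)` and `β ≥ β₀(d, λ)`, a positive lower
bound on `|Λ|⁻²Σ_{x,y}⟨S¹_xS¹_y + S²_xS²_y⟩ = 2|Λ|⁻¹ĝ¹₀` along `L = 2k → ∞`.

## References

* [LSSY2005] E. H. Lieb, R. Seiringer, J. P. Solovej, J. Yngvason, *The Mathematics of the Bose
  Gas and its Condensation*, Oberwolfach Seminars 34, Birkhäuser 2005 (arXiv:cond-mat/0610117),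
  Ch. 11, (11.2), (11.8)–(11.27).
* [AizenmanEtAl2004] M. Aizenman, E. H. Lieb, R. Seiringer, J. P. Solovej, J. Yngvason,
  Phys. Rev. A 70 (2004) 023612.
* [DLS1978] F. J. Dyson, E. H. Lieb, B. Simon, J. Stat. Phys. 18 (1978) 335–383, Thms. 3.1, 3.2,
  Lemma 4.1, Thm. 4.2, eq. (44).
* [KLS1988PRL] T. Kennedy, E. H. Lieb, B. S. Shastry, Phys. Rev. Lett. 61 (1988) 2582–2584,
  eqs. (3)–(8).

## Design choices

* All objects are thermal analogues of those of `XYOrderProofs.lean` (`xyGroundCorr`,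
  `xyStructureFactor`, `xyBondCorr`), for the Gibbs state `Matrix.gibbsState β H` of
  `H = hardCoreLatticeGas d L λ`; momenta, phases and the dispersion are the tree's
  `latticeMomentum`, `torusPhase`, `dispersion`, `torusCosSum`; junk value `0` at `L = 0`.
* (Aᵀ) is vendored in the simplified form produced by `coth x ≤ 1 + 1/x` (the form the proof
  consumes, [LSSY2005] (11.23)), with `Real.sqrt`; (Bᵀ), (Dᵀ) carry explicit (non-optimal)
  `λ`- and `T`-corrections, which is all an `∃ λ₀, β₀` statement needs.
* Even sides `L = 2k ≥ 4` wherever reflection positivity or the sublattice rotation is used.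
-/

noncomputable section

open Filter Topology Matrix Finset
open Literature.MathematicalPhysics.QuantumLattice Literature.Probability.LatticeModels Literature.Probability.Percolation Literature.MathematicalPhysics.QuantumLattice.XYOrderProofs
open scoped BigOperators

namespace Literature.Barriers.AtomisticToContinuum.BoseGas

variable {d : ℕ}

/-! ### Thermal correlation functions of the hard-core lattice gas -/

/-- The thermal `α–α` correlation `G^α(x,y) = Re ⟨S^α_x S^α_y⟩_{β,L,λ}` in the Gibbs state of
`hardCoreLatticeGas d L λ` (junk `0` at `L = 0`); `hardCoreODLRO = G¹ + G²` (components `0, 1`).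
[cite: LSSY2005, Ch. 11 §11.3 (after (11.27))] -/
def hcCorr (α : Fin 3) (β : ℝ) (L : ℕ) (lam : ℝ) (x y : TorusSite d L) : ℝ :=
  if hL : L = 0 then 0
  else
    haveI : NeZero L := ⟨hL⟩
    (thermalCorr β (hardCoreLatticeGas d L lam) (siteSpin 1 x α) (siteSpin 1 y α)).re

/-- The thermal structure factor `ĝ^α_p = ⟨S̃^α_p S̃^α_{-p}⟩ = |Λ|⁻¹ Σ_{x,y} cos(p·(x-y)) G^α(x,y)`
(momenta indexed by the dual torus point `k`, `p = 2πk/L`; junk `0` at `L = 0`).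
[cite: LSSY2005, Ch. 11 (11.8) and (11.22)] -/
def hcStructureFactor (α : Fin 3) (β : ℝ) (L : ℕ) (lam : ℝ) (k : TorusSite d L) : ℝ :=
  if hL : L = 0 then 0
  else
    haveI : NeZero L := ⟨hL⟩
    (∑ x : TorusSite d L, ∑ y : TorusSite d L,
        Real.cos (torusPhase L k (x - y)) * hcCorr α β L lam x y) / (L : ℝ) ^ d

/-- The nearest-neighbour thermal correlation in spin direction `α`, averaged over sites and
lattice directions: `e_α = (d L^d)⁻¹ Σ_x Σᵢ G^α(x, x + eᵢ)` (junk `0` at `L = 0` or `d = 0`).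
[cite: KLS1988PRL, eq. (3)] -/
def hcBondCorr (α : Fin 3) (β : ℝ) (L : ℕ) (lam : ℝ) : ℝ :=
  if hL : L = 0 then 0
  else
    haveI : NeZero L := ⟨hL⟩
    (∑ x : TorusSite d L, ∑ i : Fin d, hcCorr α β L lam x (x + Pi.single i 1)) /
      ((d : ℝ) * (L : ℝ) ^ d)

/-! ### The named intermediate results -/

/-- **(Aᵀ) The infrared bound at positive temperature.** For `d ≥ 1`, even side `L = 2k ≥ 4`,
`β > 0`, `λ ≥ 0` and every momentum `p ≠ 0` of the dual torus,
`0 ≤ ĝ¹_p ≤ 1/(2βE_p) + ½ [(Σᵢ (e₁ - e₃ cos pᵢ) + λ/4)/E_p]^{1/2}`, `E_p = Σᵢ(1 - cos pᵢ)`.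
Chain: Gaussian domination `Z(h) ≤ Z(0)` for the Gibbs state ([LSSY2005] (11.12)–(11.19);
[DLS1978] Lemma 4.1, Thm. 4.2) ⇒ Duhamel bound `(S̃¹_p,S̃¹_{-p}) ≤ 1/(2βE_p)` ([LSSY2005] (11.8);
[DLS1978] (44)) ⇒ transfer to the thermal two-point function with the double commutator
`C_p` ([DLS1978] Thms. 3.1–3.2; [LSSY2005] (11.20)–(11.22)) and `coth x ≤ 1 + 1/x`
([LSSY2005] (11.23)); `C_p` is evaluated through the bond correlations, the staggered field
contributing at most `λ/4` under the root. [cite: LSSY2005, Ch. 11 (11.8), (11.12), (11.20)–(11.23)]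
[cite: DLS1978, Thms. 3.1–3.2, Lemma 4.1, Thm. 4.2, eq. (44)] -/
def hc_infraredBound_thermal : Prop :=
  ∀ (d : ℕ), 1 ≤ d → ∀ (k : ℕ), 2 ≤ k → ∀ (β lam : ℝ), 0 < β → 0 ≤ lam →
    ∀ q : TorusSite d (2 * k), q ≠ 0 →
      0 ≤ hcStructureFactor 0 β (2 * k) lam q ∧
        hcStructureFactor 0 β (2 * k) lam q ≤
          1 / (2 * β * dispersion (latticeMomentum (2 * k) q)) +
            1 / 2 * Real.sqrt
              (((∑ i, (hcBondCorr (d := d) 0 β (2 * k) lam -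
                  hcBondCorr (d := d) 2 β (2 * k) lam * Real.cos (latticeMomentum (2 * k) q i))) +
                lam / 4) / dispersion (latticeMomentum (2 * k) q))

/-- **(Bᵀ) Kubo's inequality at positive temperature**, `|e₃| ≤ e₁ + λ/d` on even tori
`L = 2k ≥ 4`, `β > 0`, `λ ≥ 0`: the global rotation `S¹ ↦ S³` and the `π`-rotation about the
2-axis on the odd sublattice are unitary, so they preserve the partition function, and the
Peierls–Bogoliubov inequality `F(UHU⋆) ≤ F(H) + ⟨UHU⋆ - H⟩_H` gives `±d e₃ ≤ d e₁ + λ`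
(the staggered field term is moved by the rotations and is bounded by `λ|Λ|` in expectation).
Ground-state version: [KLS1988PRL] after eq. (4). [cite: KLS1988PRL, after eq. (4)]
[cite: LSSY2005, Ch. 11 (11.2)] -/
def hc_kubo_thermal : Prop :=
  ∀ (d : ℕ), 1 ≤ d → ∀ (k : ℕ), 2 ≤ k → ∀ (β lam : ℝ), 0 < β → 0 ≤ lam →
    |hcBondCorr (d := d) 2 β (2 * k) lam| ≤ hcBondCorr (d := d) 0 β (2 * k) lam + lam / d

/-- **(Cᵀ) The sum rule** (finite-volume Parseval form of [KLS1988PRL] eqs. (3), (6)) for the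
thermal structure factor: `|Λ|⁻¹ Σ_p ĝ^α_p (d⁻¹ Σᵢ cos pᵢ) = e_α` (orthogonality of the characters
of `(ℤ/Lℤ)^d` and the symmetry `G^α(x,y) = G^α(y,x)`; independent of the state).
[cite: KLS1988PRL, eq. (6)] -/
def hc_sumRule : Prop :=
  ∀ (d : ℕ), 1 ≤ d → ∀ (α : Fin 3) (L : ℕ) [NeZero L] (β lam : ℝ), 2 ≤ L →
    (∑ q : TorusSite d L, hcStructureFactor α β L lam q * (torusCosSum L q / d)) / (L : ℝ) ^ d =
      hcBondCorr (d := d) α β L lam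

/-- **(Dᵀ) The energy bound** `e₁ ≥ 1/8 - λ/(4d) - log 2/(2dβ)` (`L ≥ 3`, `β > 0`, `λ ≥ 0`):
`-2d|Λ|e₁ = ⟨H_XY⟩_β ≤ ⟨H⟩_β ≤ E₀(H) + |Λ| log 2/β` (thermal energy ≤ ground energy + entropy/β,
`dim = 2^{|Λ|}`), and `E₀(H) ≤ -d|Λ|/4 + λ|Λ|/2` by the product state with all spins along the
1-axis ([KLS1988PRL] after eq. (8): "a simple variational argument … shows `e₁ ≥ ½S²`").
[cite: KLS1988PRL, after eq. (8)] [cite: LSSY2005, Ch. 11 (11.2)] -/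
def hc_bondCorr_lower_thermal : Prop :=
  ∀ (d : ℕ), 1 ≤ d → ∀ (L : ℕ), 3 ≤ L → ∀ (β lam : ℝ), 0 < β → 0 ≤ lam →
    1 / 8 - lam / (4 * d) - Real.log 2 / (2 * d * β) ≤ hcBondCorr (d := d) 0 β L lam

/-- **(Sᵀ) `1 ↔ 2` symmetry**: `⟨S²_x S²_y⟩_β = ⟨S¹_x S¹_y⟩_β` (the rotation by `π/2` about the
3-axis is a symmetry of `hardCoreLatticeGas`, staggered field included, and the Gibbs state is
invariant under unitary symmetries of `H`). [LSSY2005, Ch. 11 §11.1: "invariant under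
simultaneous rotations of all the spins around the 3-axis"] [cite: LSSY2005, Ch. 11 §11.1] -/
def hc_corr_one_eq_zero : Prop :=
  ∀ (d L : ℕ) (β lam : ℝ) (x y : TorusSite d L), hcCorr 1 β L lam x y = hcCorr 0 β L lam x y

/-- **(Tᵀ) A priori bound** `|G^α(x,y)| ≤ ¼` (spin ½: `¼ ± S^α_xS^α_y ≥ 0` for `x ≠ y`,
`(S^α_x)² = ¼`, and Gibbs states are positive and normalised). Needed only for the boundedness
of the LRO sequence. [folklore] -/
def hc_corr_abs_le : Prop :=
  ∀ (α : Fin 3) (d L : ℕ) (β lam : ℝ) (x y : TorusSite d L), |hcCorr α β L lam x y| ≤ 1 / 4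

/-! ### API -/

/-- Junk side. [folklore] -/
@[simp] theorem hcCorr_zero_side (α : Fin 3) (β lam : ℝ) (x y : TorusSite d 0) :
    hcCorr α β 0 lam x y = 0 := by
  simp [hcCorr]

/-- Unfolding on a genuine torus. [folklore] -/
theorem hcCorr_of_neZero (α : Fin 3) (β : ℝ) (L : ℕ) [NeZero L] (lam : ℝ) (x y : TorusSite d L) :
    hcCorr α β L lam x y =
      (thermalCorr β (hardCoreLatticeGas d L lam) (siteSpin 1 x α) (siteSpin 1 y α)).re := by
  simp [hcCorr, NeZero.ne L]

/-- Unfolding the structure factor on a genuine torus. [folklore] -/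
theorem hcStructureFactor_of_neZero (α : Fin 3) (β : ℝ) (L : ℕ) [NeZero L] (lam : ℝ)
    (k : TorusSite d L) :
    hcStructureFactor α β L lam k =
      (∑ x : TorusSite d L, ∑ y : TorusSite d L,
        Real.cos (torusPhase L k (x - y)) * hcCorr α β L lam x y) / (L : ℝ) ^ d := by
  simp [hcStructureFactor, NeZero.ne L]

/-- Unfolding the bond correlation on a genuine torus. [folklore] -/
theorem hcBondCorr_of_neZero (α : Fin 3) (β : ℝ) (L : ℕ) [NeZero L] (lam : ℝ) :
    hcBondCorr (d := d) α β L lam =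
      (∑ x : TorusSite d L, ∑ i : Fin d, hcCorr α β L lam x (x + Pi.single i 1)) /
        ((d : ℝ) * (L : ℝ) ^ d) := by
  simp [hcBondCorr, NeZero.ne L]

/-- At zero momentum the structure factor is the volume average of the two-point function.
[cite: LSSY2005, Ch. 11 (after (11.27))] -/
theorem hcStructureFactor_zero_momentum (α : Fin 3) (β : ℝ) (L : ℕ) [NeZero L] (lam : ℝ) :
    hcStructureFactor α β L lam (0 : TorusSite d L) =
      (∑ x : TorusSite d L, ∑ y : TorusSite d L, hcCorr α β L lam x y) / (L : ℝ) ^ d := by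
  simp [hcStructureFactor_of_neZero]

/-- `hardCoreODLRO = G¹ + G²` (components `0` and `1`). [cite: LSSY2005, Ch. 11 §11.3] -/
theorem hardCoreODLRO_eq_add (β : ℝ) (L : ℕ) (lam : ℝ) (x y : TorusSite d L) :
    hardCoreODLRO β L lam x y = hcCorr 0 β L lam x y + hcCorr 1 β L lam x y := by
  rcases Nat.eq_zero_or_pos L with rfl | hL
  · simp
  · haveI : NeZero L := ⟨hL.ne'⟩
    rw [hardCoreODLRO_of_neZero, hcCorr_of_neZero, hcCorr_of_neZero, Fin.sum_univ_two,
      Complex.add_re]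
    rfl

/-! ### Assembly: [KLS1988PRL] eqs. (5)–(8) at positive temperature, from the named facts

The theorem `HalfFillingReflectionPositivity_of_facts` below carries out, on the finite even
tori, the argument of [LSSY2005] §11.3 in the [KLS1988PRL] arrangement: it reduces
`HalfFillingReflectionPositivity` to the facts (Aᵀ), (Bᵀ), (Cᵀ), (Dᵀ), (Sᵀ), (Tᵀ) and to two
analytic inputs already proved in the tree, `klsRiemannSum_eventually_le` (`limsup R_L < 1/√2`)
and `torusGreen_tendsto_latticeGreen` (`T_L → c_d`, `d ≥ 3`). -/

section Assembly

/-- The torus Green function at the origin is the punctured momentum average of `1/E_p`: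
`torusGreen 0 = L^{-d} Σ_{p ≠ 0} E_p⁻¹` (`T_L` of the module docstring). [cite: LSSY2005, Ch. 11 (11.23)] -/
theorem torusGreen_zero_eq (L : ℕ) [NeZero L] :
    torusGreen (0 : TorusSite d L) =
      (∑ k ∈ (univ : Finset (TorusSite d L)).erase 0, 1 / dispersion (latticeMomentum L k)) /
        (L : ℝ) ^ d := by
  rw [torusGreen]
  congr 1
  refine sum_congr rfl fun k _ => ?_
  simp

/-- `T_L ≥ 0`. [folklore] -/
theorem torusGreen_zero_nonneg (L : ℕ) [NeZero L] : 0 ≤ torusGreen (0 : TorusSite d L) := by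
  rw [torusGreen_zero_eq]
  exact div_nonneg (sum_nonneg fun k _ => div_nonneg zero_le_one (dispersion_nonneg _))
    (by positivity)

/-- `C_p ≤ d` (each cosine is at most one). [folklore] -/
theorem torusCosSum_le (L : ℕ) (q : TorusSite d L) : torusCosSum L q ≤ d := by
  calc torusCosSum L q = ∑ i : Fin d, Real.cos (latticeMomentum L q i) := rfl
    _ ≤ ∑ _i : Fin d, (1 : ℝ) := sum_le_sum fun i _ => Real.cos_le_one _
    _ = d := by simp

/-- The pointwise step (Aᵀ)+(Bᵀ) ⇒ integrand of [KLS1988PRL] (8) plus the thermal term: if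
`0 ≤ g ≤ b₀ + ½[(d e₁ - e₃ C + ℓ)/E]^{1/2}`, `|e₃| ≤ e₁ + a`, `ℓ ≤ a d`, `E, d > 0`, `b₀ ≥ 0`, then
`g (C/d) ≤ {C/d}₊ b₀ + ½ (e₁ + a)^{1/2} [((d + C)/E)^{1/2} {C/d}₊]`.
[cite: KLS1988PRL, eqs. (5), (7), (8)] [cite: LSSY2005, Ch. 11 (11.23)] -/
theorem hc_pointwise {g E C dd e₁ e₃ a b₀ ℓ : ℝ} (hg : 0 ≤ g) (hE : 0 < E) (hdd : 0 < dd)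
    (hb₀ : 0 ≤ b₀) (hA : g ≤ b₀ + 1 / 2 * Real.sqrt ((dd * e₁ - e₃ * C + ℓ) / E))
    (hB : |e₃| ≤ e₁ + a) (hℓ : ℓ ≤ a * dd) :
    g * (C / dd) ≤ max (C / dd) 0 * b₀ +
      1 / 2 * Real.sqrt (e₁ + a) * (Real.sqrt ((dd + C) / E) * max (C / dd) 0) := by
  have hea : 0 ≤ e₁ + a := (abs_nonneg _).trans hB
  rcases le_or_gt C 0 with hC | hC
  · calc g * (C / dd) ≤ 0 :=
          mul_nonpos_of_nonneg_of_nonpos hg (div_nonpos_of_nonpos_of_nonneg hC hdd.le)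
      _ ≤ _ := by positivity
  · have hCd : 0 ≤ C / dd := by positivity
    rw [max_eq_left hCd]
    -- the radicand is at most `(e₁ + a)(d + C)/E`
    have hrad : (dd * e₁ - e₃ * C + ℓ) / E ≤ (e₁ + a) * ((dd + C) / E) := by
      rw [mul_div_assoc', div_le_div_iff_of_pos_right hE]
      have h3 : -e₃ * C ≤ (e₁ + a) * C :=
        mul_le_mul_of_nonneg_right ((neg_le_abs e₃).trans hB) hC.le
      nlinarith
    have hsq : Real.sqrt ((dd * e₁ - e₃ * C + ℓ) / E) ≤
        Real.sqrt (e₁ + a) * Real.sqrt ((dd + C) / E) := by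
      rw [← Real.sqrt_mul hea]
      exact Real.sqrt_le_sqrt hrad
    calc g * (C / dd) ≤ (b₀ + 1 / 2 * Real.sqrt ((dd * e₁ - e₃ * C + ℓ) / E)) * (C / dd) :=
          mul_le_mul_of_nonneg_right hA hCd
      _ ≤ (b₀ + 1 / 2 * (Real.sqrt (e₁ + a) * Real.sqrt ((dd + C) / E))) * (C / dd) := by
          gcongr
      _ = _ := by ring

/-- **[KLS1988PRL] eq. (7) at positive temperature.** From (Aᵀ), (Bᵀ), (Cᵀ): on the even torus
of side `L = 2k ≥ 4`, for `β > 0`, `λ ≥ 0`,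
`e₁ ≤ |Λ|⁻¹ ĝ¹₀ + ½ (e₁ + λ/d)^{1/2} R_L + T_L/(2β)`.
[cite: KLS1988PRL, eq. (7)] [cite: LSSY2005, Ch. 11 (11.23)] -/
theorem hc_ineq7 (hA : hc_infraredBound_thermal) (hB : hc_kubo_thermal) (hC : hc_sumRule)
    (hd : 1 ≤ d) {k : ℕ} [NeZero (2 * k)] (hk : 2 ≤ k) {β lam : ℝ} (hβ : 0 < β)
    (hlam : 0 ≤ lam) :
    hcBondCorr (d := d) 0 β (2 * k) lam ≤
      hcStructureFactor 0 β (2 * k) lam (0 : TorusSite d (2 * k)) / ((2 * k : ℕ) : ℝ) ^ d +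
        1 / 2 * Real.sqrt (hcBondCorr (d := d) 0 β (2 * k) lam + lam / d) *
          klsRiemannSum d (2 * k) +
        1 / (2 * β) * torusGreen (0 : TorusSite d (2 * k)) := by
  have hd0 : (0 : ℝ) < d := by exact_mod_cast (show 0 < d by omega)
  have hL : (0 : ℝ) < ((2 * k : ℕ) : ℝ) ^ d := by positivity
  set e₁ := hcBondCorr (d := d) 0 β (2 * k) lam with he₁
  set e₃ := hcBondCorr (d := d) 2 β (2 * k) lam with he₃
  have hBk : |e₃| ≤ e₁ + lam / d := hB d hd k hk β lam hβ hlam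
  have hsum : ∑ q : TorusSite d (2 * k), hcStructureFactor 0 β (2 * k) lam q *
      (torusCosSum (2 * k) q / d) ≤
      hcStructureFactor 0 β (2 * k) lam (0 : TorusSite d (2 * k)) +
        (1 / 2 * Real.sqrt (e₁ + lam / d) *
          ∑ q ∈ (univ : Finset (TorusSite d (2 * k))).erase 0,
            klsIntegrand d (latticeMomentum (2 * k) q) +
        1 / (2 * β) * ∑ q ∈ (univ : Finset (TorusSite d (2 * k))).erase 0,
            1 / dispersion (latticeMomentum (2 * k) q)) := by
    rw [← add_sum_erase _ _ (mem_univ (0 : TorusSite d (2 * k))), torusCosSum_zero,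
      div_self hd0.ne', mul_one, mul_sum, mul_sum, ← sum_add_distrib]
    refine add_le_add le_rfl (sum_le_sum fun q hq => ?_)
    have hq0 : q ≠ 0 := (mem_erase.1 hq).1
    have hE := dispersion_latticeMomentum_pos (d := d) hq0
    obtain ⟨hg, hAq⟩ := hA d hd k hk β lam hβ hlam q hq0
    rw [sum_const_sub_mul_cos_latticeMomentum] at hAq
    have hb₀ : 0 ≤ 1 / (2 * β * dispersion (latticeMomentum (2 * k) q)) := by positivity
    have hℓ : lam / 4 ≤ lam / d * d := by
      rw [div_mul_cancel₀ _ hd0.ne']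
      linarith
    have hpt := hc_pointwise hg hE hd0 hb₀ hAq hBk hℓ
    rw [klsIntegrand_latticeMomentum]
    have hmax : max (torusCosSum (2 * k) q / d) 0 ≤ 1 :=
      max_le ((div_le_one hd0).2 (torusCosSum_le _ _)) zero_le_one
    have hterm : max (torusCosSum (2 * k) q / d) 0 *
        (1 / (2 * β * dispersion (latticeMomentum (2 * k) q))) ≤
        1 / (2 * β) * (1 / dispersion (latticeMomentum (2 * k) q)) := by
      calc max (torusCosSum (2 * k) q / d) 0 *
            (1 / (2 * β * dispersion (latticeMomentum (2 * k) q)))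
          ≤ 1 * (1 / (2 * β * dispersion (latticeMomentum (2 * k) q))) :=
            mul_le_mul_of_nonneg_right hmax hb₀
        _ = 1 / (2 * β) * (1 / dispersion (latticeMomentum (2 * k) q)) := by
            rw [one_mul, one_div_mul_one_div]
    linarith
  have hCk := hC d hd 0 (2 * k) β lam (by omega)
  rw [← he₁] at hCk
  rw [klsRiemannSum_of_neZero, torusGreen_zero_eq]
  calc e₁ = (∑ q : TorusSite d (2 * k), hcStructureFactor 0 β (2 * k) lam q *
          (torusCosSum (2 * k) q / d)) / ((2 * k : ℕ) : ℝ) ^ d := hCk.symm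
    _ ≤ (hcStructureFactor 0 β (2 * k) lam (0 : TorusSite d (2 * k)) +
        (1 / 2 * Real.sqrt (e₁ + lam / d) *
          ∑ q ∈ (univ : Finset (TorusSite d (2 * k))).erase 0,
            klsIntegrand d (latticeMomentum (2 * k) q) +
        1 / (2 * β) * ∑ q ∈ (univ : Finset (TorusSite d (2 * k))).erase 0,
            1 / dispersion (latticeMomentum (2 * k) q))) / ((2 * k : ℕ) : ℝ) ^ d :=
        div_le_div_of_nonneg_right hsum hL.le
    _ = _ := by rw [add_div, add_div, mul_div_assoc, mul_div_assoc, add_assoc]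

/-- The LRO sequence of `HalfFillingReflectionPositivity` on the torus of side `L = 2k ≥ 2`
equals `2 |Λ|⁻¹ ĝ¹₀` (by (Sᵀ), `⟨S¹_xS¹_y + S²_xS²_y⟩ = 2⟨S¹_xS¹_y⟩`).
[LSSY2005, Ch. 11, after (11.27): `⟨φ₀|γ|φ₀⟩ = ⟨S̃¹₀S̃¹₀ + S̃²₀S̃²₀⟩`] [cite: LSSY2005, Ch. 11 (after (11.27))] -/
theorem hc_lroSeq_eq (hS : hc_corr_one_eq_zero) (β lam : ℝ) (k : ℕ) (hk : 1 ≤ k) :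
    (∑ x ∈ halfOpenBox d (2 * k), ∑ y ∈ halfOpenBox d (2 * k),
        torusPullback (fun L x y => hardCoreODLRO (d := d) β L lam x y) (2 * k) x y) /
        ((halfOpenBox d (2 * k)).card : ℝ) ^ 2 =
      2 * (hcStructureFactor 0 β (2 * k) lam (0 : TorusSite d (2 * k)) /
        ((2 * k : ℕ) : ℝ) ^ d) := by
  haveI : NeZero (2 * k) := ⟨by omega⟩
  have hL : ((2 * k : ℕ) : ℝ) ^ d ≠ 0 := by positivity
  have hS' : ∀ x y : TorusSite d (2 * k),
      hcCorr 1 β (2 * k) lam x y = hcCorr 0 β (2 * k) lam x y := fun x y => hS d (2 * k) β lam x y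
  rw [sum_halfOpenBox_torusPullback, card_halfOpenBox, hcStructureFactor_zero_momentum]
  simp only [hardCoreODLRO_eq_add, hS', ← two_mul, ← mul_sum]
  push_cast
  field_simp

/-- Boundedness of the LRO sequence, from (Tᵀ): `|Λ|⁻² Σ_{x,y} (G¹ + G²) ≤ ½`. [folklore] -/
theorem hc_lroSeq_le (hT : hc_corr_abs_le) (β lam : ℝ) (k : ℕ) :
    (∑ x ∈ halfOpenBox d (2 * k), ∑ y ∈ halfOpenBox d (2 * k),
        torusPullback (fun L x y => hardCoreODLRO (d := d) β L lam x y) (2 * k) x y) /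
        ((halfOpenBox d (2 * k)).card : ℝ) ^ 2 ≤ 1 / 2 := by
  refine div_le_of_le_mul₀ (by positivity) (by norm_num) ?_
  have hb : ∀ x y : Site d, torusPullback (fun L x y => hardCoreODLRO (d := d) β L lam x y)
      (2 * k) x y ≤ 1 / 2 := by
    intro x y
    rw [torusPullback_apply, hardCoreODLRO_eq_add]
    have h0 := le_of_abs_le (hT 0 d (2 * k) β lam (Torus.proj (2 * k) x) (Torus.proj (2 * k) y))
    have h1 := le_of_abs_le (hT 1 d (2 * k) β lam (Torus.proj (2 * k) x) (Torus.proj (2 * k) y))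
    linarith
  calc ∑ x ∈ halfOpenBox d (2 * k), ∑ y ∈ halfOpenBox d (2 * k),
        torusPullback (fun L x y => hardCoreODLRO (d := d) β L lam x y) (2 * k) x y
      ≤ ∑ x ∈ halfOpenBox d (2 * k), ∑ y ∈ halfOpenBox d (2 * k), (1 / 2 : ℝ) :=
        sum_le_sum fun x _ => sum_le_sum fun y _ => hb x y
    _ = 1 / 2 * ((halfOpenBox d (2 * k)).card : ℝ) ^ 2 := by
        simp only [sum_const, nsmul_eq_mul]
        ring

/-- `√(1/8 + x) ≤ √2/4 + √2 x` for `x ≥ 0` (tangent line of the concave square root at `1/8`).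
[folklore] -/
theorem sqrt_one_eighth_add_le {x : ℝ} (hx : 0 ≤ x) :
    Real.sqrt (1 / 8 + x) ≤ Real.sqrt 2 / 4 + Real.sqrt 2 * x := by
  have h2 : 0 ≤ Real.sqrt 2 := Real.sqrt_nonneg 2
  have h22 : Real.sqrt 2 ^ 2 = 2 := Real.sq_sqrt (by norm_num)
  rw [Real.sqrt_le_left (by positivity)]
  nlinarith [sq_nonneg x]

/-- An eventual bound on `T_L = torusGreen 0` along even sides, for `d ≥ 3` (convergence of the
Riemann sums of `1/E_p`, `torusGreen_tendsto_latticeGreen`). [cite: DLS1978, §3 (sums vs. integrals)] -/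
theorem torusGreen_zero_eventually_le (hd : 3 ≤ d) :
    ∃ (𝒯 : ℝ) (k₀ : ℕ), 0 ≤ 𝒯 ∧ ∀ k : ℕ, k₀ ≤ k → 1 ≤ k →
      ∀ [NeZero (2 * k)], torusGreen (0 : TorusSite d (2 * k)) ≤ 𝒯 := by
  obtain ⟨L₀, hL₀⟩ := torusGreen_tendsto_latticeGreen (d := d) hd 0 one_pos
  refine ⟨|latticeGreen (0 : Site d)| + 1, L₀, by positivity, fun k hk hk1 _ => ?_⟩
  have h := hL₀ (2 * k) (even_two_mul k) (by omega)
  have h0 : Torus.proj (2 * k) (0 : Site d) = 0 := by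
    funext i; simp
  rw [h0] at h
  have := abs_le.1 h
  linarith [le_abs_self (latticeGreen (0 : Site d))]

/-- **The barrier's positive theorem from its printed intermediate results.** The facts (Aᵀ)
thermal infrared bound, (Bᵀ) thermal Kubo, (Cᵀ) sum rule, (Dᵀ) energy bound, (Sᵀ) `1 ↔ 2`
symmetry and (Tᵀ) a priori bound imply `HalfFillingReflectionPositivity`: for `d ≥ 3` there is
`λ₀ > 0` (here `λ₀ = min (d/8) (d m₀/2)`, `m₀ = (1 - √2 ρ)/8 > 0` with `ρ < 1/√2` an eventual
bound of the KLS Riemann sums) such that for `0 ≤ λ < λ₀` and all large `β` the Gibbs states of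
the hard-core lattice gas on the even tori have off-diagonal long-range order; quantitatively,
eventually in `L = 2k`,
`|Λ|⁻²Σ_{x,y}⟨S¹_xS¹_y + S²_xS²_y⟩ ≥ 2[m₀ - (5/8)(λ/d) - log 2/(2dβ) - T_L/(2β)] > 0`.
[cite: LSSY2005, Ch. 11 §11.3 (11.26)–(11.27)] [cite: KLS1988PRL, Theorem, eqs. (5)–(8)] -/
theorem HalfFillingReflectionPositivity_of_facts (hA : hc_infraredBound_thermal)
    (hB : hc_kubo_thermal) (hC : hc_sumRule) (hD : hc_bondCorr_lower_thermal)
    (hS : hc_corr_one_eq_zero) (hT : hc_corr_abs_le) :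
    Literature.Barriers.AtomisticToContinuum.HalfFillingReflectionPositivity := by
  intro d hd
  have hd1 : 1 ≤ d := by omega
  have hd0 : (0 : ℝ) < d := by exact_mod_cast (show 0 < d by omega)
  -- the eventual bound on the KLS Riemann sums
  obtain ⟨ρ, hρlt, hρev⟩ := klsRiemannSum_eventually_le d (by omega)
  set ρ' : ℝ := max ρ 0 with hρ'_def
  have hρ'0 : 0 ≤ ρ' := le_max_right _ _
  have hρ'lt : ρ' < Real.sqrt 2 / 2 := max_lt hρlt (by positivity)
  have h2pos : (0 : ℝ) < Real.sqrt 2 := by positivity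
  have h22 : Real.sqrt 2 * Real.sqrt 2 = 2 := Real.mul_self_sqrt (by norm_num)
  have hρ'1 : Real.sqrt 2 * ρ' < 1 := by nlinarith
  -- the margin at `λ = 0`, `T = 0`
  set m₀ : ℝ := (1 - Real.sqrt 2 * ρ') / 8 with hm₀_def
  have hm₀ : 0 < m₀ := by rw [hm₀_def]; linarith
  have hm₀le : m₀ ≤ 1 / 8 := by
    rw [hm₀_def]
    have : 0 ≤ Real.sqrt 2 * ρ' := by positivity
    linarith
  -- the threshold `λ₀`
  refine ⟨min ((d : ℝ) / 8) (d * m₀ / 2), lt_min (by positivity) (by positivity), ?_⟩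
  intro lam hlam hlamlt
  have hlam8 : lam / d < 1 / 8 := by
    rw [div_lt_iff₀ hd0]
    have := lt_of_lt_of_le hlamlt (min_le_left _ _)
    linarith
  have hlamm : lam / d < m₀ / 2 := by
    rw [div_lt_iff₀ hd0]
    have := lt_of_lt_of_le hlamlt (min_le_right _ _)
    linarith
  have hlamd : 0 ≤ lam / d := by positivity
  set m₁ : ℝ := m₀ - 5 / 8 * (lam / d) with hm₁_def
  have hm₁ : 0 < m₁ := by rw [hm₁_def]; linarith
  -- the thermal term `T_L`
  obtain ⟨𝒯, k₀, h𝒯0, h𝒯⟩ := torusGreen_zero_eventually_le (d := d) hd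
  -- the threshold `β₀`
  set ℓ : ℝ := Real.log 2 / (2 * d) with hℓ_def
  have hℓ0 : 0 ≤ ℓ := by rw [hℓ_def]; positivity
  set β₀ : ℝ := 32 * ℓ + 1 + 2 * (ℓ + 𝒯 / 2) / m₁ with hβ₀_def
  have hβ₀pos : 0 < β₀ := by rw [hβ₀_def]; positivity
  refine ⟨β₀, hβ₀pos, fun β hβ => ?_⟩
  have hβpos : 0 < β := hβ₀pos.trans_le hβ
  have hβ32 : 32 * ℓ ≤ β := by
    have : (0 : ℝ) ≤ 2 * (ℓ + 𝒯 / 2) / m₁ := by positivity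
    linarith
  have hβm : 2 * (ℓ + 𝒯 / 2) / m₁ ≤ β := by linarith
  -- consequences: `ℓ/β ≤ 1/32` and `ℓ/β + 𝒯/(2β) ≤ m₁/2`
  have hℓβ : ℓ / β ≤ 1 / 32 := by
    rw [div_le_iff₀ hβpos]; linarith
  have hτβ : ℓ / β + 𝒯 / (2 * β) ≤ m₁ / 2 := by
    rw [div_add_div _ _ hβpos.ne' (by positivity), div_le_iff₀ (by positivity)]
    rw [div_le_iff₀ hm₁] at hβm
    nlinarith
  rw [hasEvenTorusLRO_iff]
  -- eventually `R_{2k} ≤ ρ'`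
  have h2k : Tendsto (fun k : ℕ => 2 * k) atTop atTop :=
    tendsto_atTop_atTop.2 fun b => ⟨b, fun k hk => by omega⟩
  have hRk : ∀ᶠ k : ℕ in atTop, klsRiemannSum d (2 * k) ≤ ρ' :=
    (h2k.eventually hρev).mono fun k hk => hk.trans (le_max_left _ _)
  have hsqrt2 : Real.sqrt 2 < 2 := by
    rw [Real.sqrt_lt' (by norm_num)]; norm_num
  -- eventually the LRO sequence is `≥ m₁`
  have hev : ∀ᶠ k : ℕ in atTop, m₁ ≤
      (∑ x ∈ halfOpenBox d (2 * k), ∑ y ∈ halfOpenBox d (2 * k),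
          torusPullback (fun L x y => hardCoreODLRO (d := d) β L lam x y) (2 * k) x y) /
        ((halfOpenBox d (2 * k)).card : ℝ) ^ 2 := by
    filter_upwards [hRk, eventually_ge_atTop 2, eventually_ge_atTop k₀] with k hk hk2 hkk₀
    haveI : NeZero (2 * k) := ⟨by omega⟩
    rw [hc_lroSeq_eq hS β lam k (by omega)]
    have h7 := hc_ineq7 hA hB hC hd1 hk2 hβpos hlam
    set e₁ := hcBondCorr (d := d) 0 β (2 * k) lam with he₁
    set g₀ := hcStructureFactor 0 β (2 * k) lam (0 : TorusSite d (2 * k)) /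
      ((2 * k : ℕ) : ℝ) ^ d with hg₀
    set R := klsRiemannSum d (2 * k) with hR_def
    set T := torusGreen (0 : TorusSite d (2 * k)) with hT_def
    have hR0 : 0 ≤ R := klsRiemannSum_nonneg _ _
    have hT0 : 0 ≤ T := torusGreen_zero_nonneg (d := d) (2 * k)
    have hT𝒯 : T ≤ 𝒯 := h𝒯 k hkk₀ (by omega)
    -- (Dᵀ): `s ≤ e₁`, with `s = 1/8 - λ/(4d) - ℓ/β ≥ 1/16`
    have hDk : 1 / 8 - lam / (4 * d) - Real.log 2 / (2 * d * β) ≤ e₁ :=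
      hD d hd1 (2 * k) (by omega) β lam hβpos hlam
    have hsℓ : Real.log 2 / (2 * d * β) = ℓ / β := by
      rw [hℓ_def, div_div]
    have hlam4 : lam / (4 * d) = (lam / d) / 4 := by
      rw [div_div, mul_comm]
    rw [hsℓ, hlam4] at hDk
    have hℓβ0 : 0 ≤ ℓ / β := by positivity
    -- abbreviation `s`
    obtain ⟨s, hs_def⟩ : ∃ s : ℝ, s = 1 / 8 - lam / d / 4 - ℓ / β := ⟨_, rfl⟩
    have hse : s ≤ e₁ := by rw [hs_def]; exact hDk
    have hs16 : 1 / 16 ≤ s := by rw [hs_def]; linarith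
    have hsa : 0 ≤ s + lam / d := by linarith
    -- the monotone step on `t ↦ t - ½ R √(t + λ/d)`
    have hR4 : R ≤ 4 * Real.sqrt (s + lam / d) := by
      have h14 : (1 / 4 : ℝ) ≤ Real.sqrt (s + lam / d) := by
        rw [Real.le_sqrt (by norm_num) hsa]; linarith
      linarith
    have hmono := kls_monotone_step hsa (show s + lam / d ≤ e₁ + lam / d by linarith) hR4
    -- `½ R √(s + λ/d) ≤ √2 ρ'/8 + (3/8)(λ/d)`
    have hsx : s + lam / d ≤ 1 / 8 + 3 / 4 * (lam / d) := by rw [hs_def]; linarith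
    have hsqrt : Real.sqrt (s + lam / d) ≤
        Real.sqrt 2 / 4 + Real.sqrt 2 * (3 / 4 * (lam / d)) :=
      (Real.sqrt_le_sqrt hsx).trans (sqrt_one_eighth_add_le (by positivity))
    have hRs : 1 / 2 * Real.sqrt (s + lam / d) * R ≤
        Real.sqrt 2 * ρ' / 8 + 3 / 8 * (lam / d) := by
      have h1 : 1 / 2 * Real.sqrt (s + lam / d) * R ≤
          1 / 2 * (Real.sqrt 2 / 4 + Real.sqrt 2 * (3 / 4 * (lam / d))) * ρ' :=
        mul_le_mul (mul_le_mul_of_nonneg_left hsqrt (by norm_num)) hk hR0 (by positivity)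
      have h2 : (Real.sqrt 2 * ρ') * (3 / 4 * (lam / d)) ≤ 1 * (3 / 4 * (lam / d)) :=
        mul_le_mul_of_nonneg_right hρ'1.le (by positivity)
      have h3 : 1 / 2 * (Real.sqrt 2 / 4 + Real.sqrt 2 * (3 / 4 * (lam / d))) * ρ' =
          Real.sqrt 2 * ρ' / 8 + (Real.sqrt 2 * ρ') * (3 / 4 * (lam / d)) / 2 := by ring
      linarith
    -- the thermal term
    have hTβ : 1 / (2 * β) * T ≤ 𝒯 / (2 * β) := by
      rw [one_div_mul_eq_div]
      exact div_le_div_of_nonneg_right hT𝒯 (by positivity)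
    -- assemble (all linear from here)
    have key : s - 1 / 2 * Real.sqrt (s + lam / d) * R - 1 / (2 * β) * T ≤ g₀ := by
      linarith [h7, hmono]
    linarith [key, hRs, hTβ, hτβ, hs_def, hm₁_def, hm₀_def]
  exact hm₁.trans_le
    (le_liminf_of_le (isCoboundedUnder_ge_of_le atTop fun k => hc_lroSeq_le hT β lam k) hev)

end Assembly

end Literature.Barriers.AtomisticToContinuum.BoseGas
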